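import Mathlib

/-!
# RiemannHypothesis / LeeYang — `LeeyangGhsFaceXi`, part 1: calculus of the Hadamard pair terms

Helper file for item stmt-RiemannHypothesis-0454 (`LeeyangGhsFaceXi`: `(log ξ)'` is concave on
`[1/2, ∞)`). For a pair of zeros `ρ = β + iγ`, `1 − ρ̄` of `ξ`, the real part of
`1/(σ−ρ) + 1/(σ−(1−ρ))` on the real axis is `u(σ−β) + u(σ−(1−β))` with `u(a) = a/(a²+c)`,
`c = γ²`. Here: the first three derivatives of `u`, the sign lemmas for
`g(a) = u''(a)/2 = a(a²−3c)/(a²+c)³`, and the concavity of the pair term on `[1/2, 24]` when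
either `β = 1/2` and `c ≥ 196` (zeros on the critical line, `|γ| > 14`) or `c ≥ 10201` (zeros off
the line have `|γ| > 101`). Also: concavity is preserved under pointwise `HasSum`.
-/

noncomputable section

open Set

-- D-0017: single-problem summit ⇒ namespace `Summit.RiemannHypothesis.RiemannHypothesis.…` by design
-- (the Summits library sets `weak.linter.dupNamespace = false`; repeated here for stand-alone checks).
set_option linter.dupNamespace false

namespace Summit.RiemannHypothesis.RiemannHypothesis.Theorems

/-- Concavity from two everywhere-defined derivatives with `f'' ≤ 0` on a convex set. [folklore] -/
theorem LeeYangGhs.concaveOn_of_hasDerivAt2_nonpos {D : Set ℝ} (hD : Convex ℝ D)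
    {f f' f'' : ℝ → ℝ} (hf' : ∀ x, HasDerivAt f (f' x) x) (hf'' : ∀ x, HasDerivAt f' (f'' x) x)
    (h : ∀ x ∈ D, f'' x ≤ 0) : ConcaveOn ℝ D f :=
  concaveOn_of_hasDerivWithinAt2_nonpos hD (fun x _ => (hf' x).continuousAt.continuousWithinAt)
    (fun x _ => (hf' x).hasDerivWithinAt) (fun x _ => (hf'' x).hasDerivWithinAt)
    (fun x hx => h x (interior_subset hx))

/-- A pointwise `HasSum` of concave functions is concave. [folklore] -/
theorem LeeYangGhs.concaveOn_of_hasSum {ι : Type*} {s : Set ℝ} {f : ι → ℝ → ℝ} {g : ℝ → ℝ}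
    (hs : Convex ℝ s) (hf : ∀ i, ConcaveOn ℝ s (f i))
    (hg : ∀ x ∈ s, HasSum (fun i => f i x) (g x)) : ConcaveOn ℝ s g := by
  refine ⟨hs, fun x hx y hy a b ha hb hab => ?_⟩
  have h1 : HasSum (fun i => a • f i x + b • f i y) (a • g x + b • g y) :=
    ((hg x hx).const_smul a).add ((hg y hy).const_smul b)
  have h2 : HasSum (fun i => f i (a • x + b • y)) (g (a • x + b • y)) :=
    hg _ (hs hx hy ha hb hab)
  exact hasSum_le (fun i => (hf i).2 hx hy ha hb hab) h1 h2

/-- `d/da [a/(a²+c)] = (c − a²)/(a²+c)²` for `c > 0`. [folklore] -/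
theorem LeeYangGhs.hasDerivAt_u {c : ℝ} (hc : 0 < c) (a : ℝ) :
    HasDerivAt (fun a : ℝ => a / (a ^ 2 + c)) ((c - a ^ 2) / (a ^ 2 + c) ^ 2) a := by
  have h1 : HasDerivAt (fun a : ℝ => a ^ 2 + c) (2 * a) a := by
    simpa using (hasDerivAt_pow 2 a).add_const c
  have hne : a ^ 2 + c ≠ 0 := by positivity
  refine ((hasDerivAt_id' a).fun_div h1 hne).congr_deriv ?_
  field_simp
  ring

/-- `d/da [(c − a²)/(a²+c)²] = 2 · a(a²−3c)/(a²+c)³` for `c > 0`. [folklore] -/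
theorem LeeYangGhs.hasDerivAt_u' {c : ℝ} (hc : 0 < c) (a : ℝ) :
    HasDerivAt (fun a : ℝ => (c - a ^ 2) / (a ^ 2 + c) ^ 2)
      (2 * (a * (a ^ 2 - 3 * c) / (a ^ 2 + c) ^ 3)) a := by
  have h1 : HasDerivAt (fun a : ℝ => c - a ^ 2) (-(2 * a)) a := by
    simpa using (hasDerivAt_pow 2 a).const_sub c
  have h2 : HasDerivAt (fun a : ℝ => (a ^ 2 + c) ^ 2) (2 * (a ^ 2 + c) * (2 * a)) a := by
    have h0 : HasDerivAt (fun a : ℝ => a ^ 2 + c) (2 * a) a := by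
      simpa using (hasDerivAt_pow 2 a).add_const c
    simpa using h0.fun_pow 2
  have hne : (a ^ 2 + c) ^ 2 ≠ 0 := by positivity
  refine (h1.fun_div h2 hne).congr_deriv ?_
  have hne' : a ^ 2 + c ≠ 0 := by positivity
  field_simp
  ring

/-- `d/da [a(a²−3c)/(a²+c)³] = 3(−a⁴ + 6a²c − c²)/(a²+c)⁴` for `c > 0`. [folklore] -/
theorem LeeYangGhs.hasDerivAt_g {c : ℝ} (hc : 0 < c) (a : ℝ) :
    HasDerivAt (fun a : ℝ => a * (a ^ 2 - 3 * c) / (a ^ 2 + c) ^ 3)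
      (3 * (-a ^ 4 + 6 * a ^ 2 * c - c ^ 2) / (a ^ 2 + c) ^ 4) a := by
  have h1 : HasDerivAt (fun a : ℝ => a * (a ^ 2 - 3 * c)) (1 * (a ^ 2 - 3 * c) + a * (2 * a)) a := by
    have : HasDerivAt (fun a : ℝ => a ^ 2 - 3 * c) (2 * a) a := by
      simpa using (hasDerivAt_pow 2 a).sub_const (3 * c)
    exact (hasDerivAt_id' a).fun_mul this
  have h2 : HasDerivAt (fun a : ℝ => (a ^ 2 + c) ^ 3) (3 * (a ^ 2 + c) ^ 2 * (2 * a)) a := by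
    have h0 : HasDerivAt (fun a : ℝ => a ^ 2 + c) (2 * a) a := by
      simpa using (hasDerivAt_pow 2 a).add_const c
    simpa using h0.fun_pow 3
  have hne : (a ^ 2 + c) ^ 3 ≠ 0 := by positivity
  refine (h1.fun_div h2 hne).congr_deriv ?_
  have hne' : a ^ 2 + c ≠ 0 := by positivity
  field_simp
  ring

/-- `g(a) = a(a²−3c)/(a²+c)³ ≤ 0` for `0 ≤ a`, `a² ≤ 3c`. [folklore] -/
theorem LeeYangGhs.g_nonpos {c a : ℝ} (hc : 0 < c) (ha : 0 ≤ a) (h : a ^ 2 ≤ 3 * c) :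
    a * (a ^ 2 - 3 * c) / (a ^ 2 + c) ^ 3 ≤ 0 := by
  apply div_nonpos_of_nonpos_of_nonneg
  · exact mul_nonpos_of_nonneg_of_nonpos ha (by linarith)
  · positivity

/-- `g` is odd. [folklore] -/
theorem LeeYangGhs.g_neg (c a : ℝ) :
    (-a) * ((-a) ^ 2 - 3 * c) / ((-a) ^ 2 + c) ^ 3 = -(a * (a ^ 2 - 3 * c) / (a ^ 2 + c) ^ 3) := by
  ring

/-- `g` is antitone on `[−A, A]` when `6A² ≤ c`. [folklore] -/
theorem LeeYangGhs.g_antitoneOn {c A : ℝ} (hc : 0 < c) (hA : 6 * A ^ 2 ≤ c) :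
    AntitoneOn (fun a : ℝ => a * (a ^ 2 - 3 * c) / (a ^ 2 + c) ^ 3) (Icc (-A) A) := by
  refine antitoneOn_of_deriv_nonpos (convex_Icc _ _)
    (fun x _ => (LeeYangGhs.hasDerivAt_g hc x).continuousAt.continuousWithinAt)
    (fun x _ => (LeeYangGhs.hasDerivAt_g hc x).differentiableAt.differentiableWithinAt) ?_
  intro x hx
  rw [interior_Icc] at hx
  rw [(LeeYangGhs.hasDerivAt_g hc x).deriv]
  apply div_nonpos_of_nonpos_of_nonneg _ (by positivity)
  have hx2 : x ^ 2 ≤ A ^ 2 := by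
    have : |x| ≤ |A| := by
      rw [abs_le]
      constructor <;> nlinarith [hx.1, hx.2, abs_nonneg A, le_abs_self A, neg_abs_le A]
    simpa only [sq_abs] using pow_le_pow_left₀ (abs_nonneg x) this 2
  have h6 : 6 * x ^ 2 * c ≤ c * c := by nlinarith
  nlinarith [sq_nonneg (x ^ 2), sq_nonneg c]

/-- Pair sign lemma: `g(a₁) + g(a₂) ≤ 0` when `|aᵢ| ≤ A`, `6A² ≤ c`, `a₁ + a₂ ≥ 0`. [folklore] -/
theorem LeeYangGhs.g_add_g_nonpos {c A a₁ a₂ : ℝ} (hc : 0 < c) (hA : 6 * A ^ 2 ≤ c)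
    (h1 : |a₁| ≤ A) (h2 : |a₂| ≤ A) (h12 : 0 ≤ a₁ + a₂) :
    a₁ * (a₁ ^ 2 - 3 * c) / (a₁ ^ 2 + c) ^ 3 + a₂ * (a₂ ^ 2 - 3 * c) / (a₂ ^ 2 + c) ^ 3 ≤ 0 := by
  have hmono := LeeYangGhs.g_antitoneOn hc hA
  have ha1 : a₁ ∈ Icc (-A) A := ⟨(abs_le.1 h1).1, (abs_le.1 h1).2⟩
  have ha2 : -a₂ ∈ Icc (-A) A := ⟨by linarith [(abs_le.1 h2).2], by linarith [(abs_le.1 h2).1]⟩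
  have key := hmono ha2 ha1 (by linarith)
  simp only at key
  rw [LeeYangGhs.g_neg] at key
  linarith

/-- **Concavity of a Hadamard pair term.** For `0 < c`, the function
`σ ↦ (σ−β)/((σ−β)²+c) + (σ−(1−β))/((σ−(1−β))²+c)` is concave on `[1/2, 24]` provided either
`β = 1/2` and `196 ≤ c`, or `0 < β < 1` and `10201 ≤ c`. [folklore] -/
theorem LeeYangGhs.pairTerm_concaveOn {β c : ℝ} (hβ0 : 0 < β) (hβ1 : β < 1)
    (h : (β = 1 / 2 ∧ 196 ≤ c) ∨ 10201 ≤ c) :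
    ConcaveOn ℝ (Icc (1 / 2 : ℝ) 24)
      (fun σ : ℝ => (σ - β) / ((σ - β) ^ 2 + c) + (σ - (1 - β)) / ((σ - (1 - β)) ^ 2 + c)) := by
  have hc : 0 < c := by rcases h with ⟨-, h⟩ | h <;> linarith
  refine LeeYangGhs.concaveOn_of_hasDerivAt2_nonpos (convex_Icc _ _)
    (f' := fun σ => (c - (σ - β) ^ 2) / ((σ - β) ^ 2 + c) ^ 2 +
      (c - (σ - (1 - β)) ^ 2) / ((σ - (1 - β)) ^ 2 + c) ^ 2)
    (f'' := fun σ => 2 * ((σ - β) * ((σ - β) ^ 2 - 3 * c) / ((σ - β) ^ 2 + c) ^ 3) +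
      2 * ((σ - (1 - β)) * ((σ - (1 - β)) ^ 2 - 3 * c) / ((σ - (1 - β)) ^ 2 + c) ^ 3))
    (fun σ => ?_) (fun σ => ?_) (fun σ hσ => ?_)
  · exact ((LeeYangGhs.hasDerivAt_u hc (σ - β)).comp_sub_const σ β).add
      ((LeeYangGhs.hasDerivAt_u hc (σ - (1 - β))).comp_sub_const σ (1 - β))
  · exact ((LeeYangGhs.hasDerivAt_u' hc (σ - β)).comp_sub_const σ β).add
      ((LeeYangGhs.hasDerivAt_u' hc (σ - (1 - β))).comp_sub_const σ (1 - β))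
  · obtain ⟨hσ1, hσ2⟩ := hσ
    rcases h with ⟨rfl, h196⟩ | hbig
    · have ha : 0 ≤ σ - 1 / 2 := by linarith
      have hsq : (σ - 1 / 2) ^ 2 ≤ 3 * c := by nlinarith
      have e : σ - (1 - 1 / 2) = σ - 1 / 2 := by ring
      rw [e]
      have := LeeYangGhs.g_nonpos hc ha hsq
      linarith
    · have hA : 6 * (24 : ℝ) ^ 2 ≤ c := by linarith
      have h1 : |σ - β| ≤ 24 := abs_le.2 ⟨by linarith, by linarith⟩
      have h2 : |σ - (1 - β)| ≤ 24 := abs_le.2 ⟨by linarith, by linarith⟩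
      have := LeeYangGhs.g_add_g_nonpos hc hA h1 h2 (by linarith)
      linarith

end Summit.RiemannHypothesis.RiemannHypothesis.Theorems
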